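import Literature.IUT.LogThetaLattice.GlobalFrobenioidModelsPlaces
import Literature.IUT.LogThetaLattice.GlobalFrobenioidModelsProofs
import Literature.IUT.LogThetaLattice.GlobalKummerNonInterference
import Literature.IUT.LogThetaLattice.PacketLogVolumesPrincipalBridge
import HarnessLib

/-!
# [IUTchIII] Example 3.6 (ii) ⟷ Proposition 3.9 (iii) AT THE MODEL: the objects `𝔍` of `𝓕⊛_𝔪𝔬𝔡` for a number
# field, their arithmetic divisors, "`μ^log(𝔍)` = degree of the arithmetic line bundle determined by `𝔍`",
# and invariance of the global log-volume under `𝔍 ↦ f·𝔍` (abc-iut cell, layer L6)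

S. Mochizuki, *Inter-universal Teichmüller theory III*, kurims manuscript (May 2020):
* Example 3.6 (ii), p. 107 l. 36 – p. 108 l. 17 [claim: Mochizuki2012, status: disputed]: objects of `𝓕⊛_𝔪𝔬𝔡` are
  "collections `𝔍 = {𝔍_v}_{v∈𝕍}` of 'fractional ideals' … such that `𝔍_v = 𝒪_{K_v}` for all but finitely many
  `v`"; "for any element `f ∈ F^×_mod`, one obtains an object `f·𝔍`"; an elementary morphism `𝔍₁ → 𝔍₂` is an
  `f` with "`f·𝔍_{1,v} ⊆ 𝔍_{2,v}` for each `v`"; a morphism is "a positive integer `n` and an elementary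
  morphism `(𝔍₁)^{⊗n} → 𝔍₂`"; and `𝔍 ↦` "the arithmetic line bundle on `S_mod` obtained from the trivial
  arithmetic line bundle … by modifying the integral structure … at `v` in the fashion prescribed by `𝔍_v`";
* Proposition 3.9 (iii), p. 117 l. 8–17: the global log-volume "is invariant with respect to multiplication
  by elements of `(†𝕄⊛_mod)_α`" and, for objects `𝔍` of `(†𝓕⊛_𝔪𝔬𝔡)_α`, "the global log-volume `μ^log_{A,𝕍_ℚ}(𝔍)` is
  equal to the degree of the arithmetic line bundle determined by `𝔍` … relative to a suitable
  normalization";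
* Remark 3.10.1 (iii), p. 150 l. 36 ff.: "one may nevertheless compute — i.e., … 'estimate' — the global
  arithmetic degrees of objects of '`𝓕⊛_𝔪𝔬𝔡`' by computing log-volumes".

INPUTS (all by NAME, nothing re-declared): abc-iut-L6-t4's `GlobalFrobenioidModels.FrakObj`, `.smul`,
`.tensorPow`, `.IsElemHom`, `.IsHom` (statement file `GlobalFrobenioidModels.lean`; abc-iut-L6-t6's companion
`GlobalFrobenioidModelsProofs.lean` for `FrakObj.ext_cls`) and `Prop39iii_degree`,
`Remark3101iii_estimate` (`PacketLogVolumes.lean`, `GlobalKummerNonInterference.lean`); abc-iut-L6-d1's MODEL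
data `ModelPlaces F`, `betaModel`, `nonnegModel` (`GlobalFrobenioidModelsPlaces.lean`: all places of the
number field, `β_v = ord_v` resp. `−log|·|_v`, `Γ_v = ℝ ⊇ ℝ_{≥0}`); abc-iut-L6-d3's arithmetic-divisor model of
Prop. 3.9 (iii) (`PacketLogVolumesPrincipalBridge.lean`: `divisorLogVolume`, `globalRegionEquivADivisor`,
`principalAction`, `globalLogVolume_eq_degF`, `prop39iii_invariance_divisorModel`); the campaign-S divisor
files of abc-iut-S2 / abc-iut-L6-t16 (`ADivisor`, `degF`, `ADivisor.principal`, `degF_principal`).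

RESULTS (sorry-free):
* `betaFin_apply` / `betaModel_inl_apply`: d1's `β_v` at a finite place IS the campaign-S order `ord F v`;
  `finite_betaModel_ne_zero` DISCHARGES at the model the finiteness hypothesis `hf` of t4's `FrakObj.smul`
  ("every `f` is a unit at almost all places");
* `frakDivisor : FrakObj ↦ ADiv_ℝ(F)` — the arithmetic divisor "determined by `𝔍`" (coordinates
  `−[F_v:ℝ]·[λ_v]` resp. `−[λ_v]`), a BIJECTION (`frakObjEquivADivisor`), with `frakDivisor (f·𝔍) = frakDivisor 𝔍
  − ADiv(f)` (`frakDivisor_smul`), `frakDivisor (𝔍^{⊗n}) = n • frakDivisor 𝔍`, and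
  `IsElemHom 𝔍₁ 𝔍₂ f ↔ (frakDivisor 𝔍₂ − frakDivisor 𝔍₁ + ADiv(f))` effective (`isElemHom_iff_isEffective`);
* **`prop39iii_degree_frak`** — **IUTchIII:Prop3.9(iii)** last sentence for t4's OWN objects: with
  `frakRegion 𝔍` the global region of `𝔍` and `frakDeg 𝔍 := deg_F(frakDivisor 𝔍)`, `Prop39iii_degree` HOLDS
  with `c = 1` (`globalLogVolume_frakRegion : μ^log(𝔍) = deg 𝔍`);
* **`frakRegion_smul`** / **`globalLogVolume_frakRegion_smul`** — t4's Example-3.6 action `𝔍 ↦ f·𝔍` IS the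
  bridge's `principalAction f`, so `μ^log(f·𝔍) = μ^log(𝔍)` (the invariance clause, via the product formula)
  and `frakDeg (f·𝔍) = frakDeg 𝔍`;
* `frakDeg_le_of_isElemHom` / `frakDeg_mul_le_of_isHom` — degrees increase along (elementary) morphisms of
  `𝓕⊛_𝔪𝔬𝔡` (`deg 𝔍₂ − deg 𝔍₁ = deg(effective) ≥ 0`, `deg ADiv(f) = 0`);
* **`remark3101iii_estimate_frak`** — **IUTchIII:Rmk3.10.1(iii)**'s typed ESTIMATE holds at the model for the
  coordinatewise order on global regions: `𝔍`'s region `⊆ S` ⇒ `deg 𝔍 ≤ μ^log(S)`.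

HONEST FRAMING: classical bookkeeping for a number field (no Frobenioid category structure is built here —
the "is a Frobenioid" clause of Ex. 3.6 (ii) remains the subject of the [FrdI] Thm 5.2 model-Frobenioid
files of layer L1); nothing is asserted about [IUTchIII] Cor. 3.12; no side is taken; typed ≠ discharged
elsewhere. [claim: Mochizuki2012, status: disputed] for the quoted sentences.
-/

noncomputable section

namespace Literature.IUT.LogThetaLattice

open Literature.IUT.LogVolume Literature.IUT.LogThetaLattice.GlobalFrobenioidModels NumberField
  IsDedekindDomain Finset

universe u

variable {F : Type u} [Field F] [NumberField F]

/-! ### d1's `β_v` versus the campaign-S order and principal divisor -/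

/-- At a finite place, d1's `β_v = ord_v` IS the campaign-S order: `β_v(f) = ord F v f`.
[claim: Mochizuki2012, status: disputed] -/
theorem betaFin_apply (w : HeightOneSpectrum (𝓞 F)) (f : Fˣ) :
    betaFin w (Additive.ofMul f) = (ord F w (f : F) : ℝ) := by
  simp only [betaFin, AddMonoidHom.neg_apply, AddMonoidHom.coe_comp, Function.comp_apply,
    MonoidHom.coe_toAdditiveLeft, toMul_ofMul, Int.coe_castAddHom, ord]
  rw [← HeightOneSpectrum.valuationOfNeZero_eq,
    show WithZero.log ((w.valuationOfNeZero f : Multiplicative ℤ) : WithZero (Multiplicative ℤ)) =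
      Multiplicative.toAdd (w.valuationOfNeZero f) from rfl]
  push_cast
  ring

/-- `β_v(f)` at a finite place `v` is the finite coefficient `ADiv(f)_v = ord_v(f)` of the principal divisor.
[claim: Mochizuki2012, status: disputed] -/
theorem betaModel_inl_apply (w : HeightOneSpectrum (𝓞 F)) (f : Fˣ) :
    betaModel (Sum.inl w : ModelPlaces F) (Additive.ofMul f) = ADivisor.principal (f : F) (Sum.inr w) := by
  rw [ADivisor.principal_apply_inr]
  exact betaFin_apply w f

/-- `β_v(f) = −log|f|_v` at an archimedean place; the archimedean coefficient of `ADiv(f)` is `[F_v:ℝ]` times it.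
[claim: Mochizuki2012, status: disputed] -/
theorem mult_mul_betaModel_inr_apply (v : InfinitePlace F) (f : Fˣ) :
    (v.mult : ℝ) * betaModel (Sum.inr v : ModelPlaces F) (Additive.ofMul f) =
      ADivisor.principal (f : F) (Sum.inl v) := by
  rw [ADivisor.principal_apply_inl]
  change (v.mult : ℝ) * -Real.log (v ((Additive.toMul (Additive.ofMul f) : Fˣ) : F)) = _
  rw [toMul_ofMul]
  ring

/-- **IUTchIII:Ex3.6(ii)** (kurims p.107 l.36) the hypothesis `hf` of t4's `FrakObj.smul` DISCHARGED at the
model: every `f ∈ F^×` satisfies `β_v(f) = 0` for all but finitely many places `v` (it is a unit at almost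
all finite places; there are finitely many archimedean places). [claim: Mochizuki2012, status: disputed] -/
theorem finite_betaModel_ne_zero (f : Fˣ) :
    {v : ModelPlaces F | betaModel v (Additive.ofMul f) ≠ 0}.Finite := by
  have hfin : {w : HeightOneSpectrum (𝓞 F) | betaModel (Sum.inl w : ModelPlaces F) (Additive.ofMul f) ≠ 0}.Finite := by
    refine (finite_setOf_ord_ne_zero F (f : F)).subset fun w hw => ?_
    simp only [Set.mem_setOf_eq] at hw ⊢
    rw [betaModel_inl_apply, ADivisor.principal_apply_inr] at hw
    exact_mod_cast hw
  have harc : {v : InfinitePlace F | betaModel (Sum.inr v : ModelPlaces F) (Additive.ofMul f) ≠ 0}.Finite :=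
    Set.toFinite _
  refine ((hfin.image Sum.inl).union (harc.image Sum.inr)).subset ?_
  rintro (w | v) h
  · exact Or.inl ⟨w, h, rfl⟩
  · exact Or.inr ⟨v, h, rfl⟩

/-! ### The arithmetic divisor determined by `𝔍` -/

/-- The MODEL objects of `𝓕⊛_𝔪𝔬𝔡` ([IUTchIII] Ex. 3.6 (ii)): t4's `FrakObj` over d1's model data (all places,
`Γ_v = ℝ`). [claim: Mochizuki2012, status: disputed] -/
abbrev ModelFrakObj (F : Type u) [Field F] [NumberField F] : Type u :=
  FrakObj (ModelPlaces F) (fun _ => ℝ)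

/-- The weight `[F_v : ℝ]` (archimedean) resp. `1` (finite) converting a class `[λ_v]` into a divisor
coordinate. [claim: Mochizuki2012, status: disputed] -/
def placeMult : Place F → ℝ := Sum.elim (fun v => (v.mult : ℝ)) fun _ => 1

omit [NumberField F] in
/-- `placeMult` at an archimedean place. [claim: Mochizuki2012, status: disputed] -/
@[simp] theorem placeMult_inl (v : InfinitePlace F) : placeMult (Sum.inl v : Place F) = v.mult := rfl

omit [NumberField F] in
/-- `placeMult` at a finite place. [claim: Mochizuki2012, status: disputed] -/
@[simp] theorem placeMult_inr (w : HeightOneSpectrum (𝓞 F)) : placeMult (Sum.inr w : Place F) = 1 := rfl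

omit [NumberField F] in
/-- The weights are positive. [claim: Mochizuki2012, status: disputed] -/
theorem placeMult_pos (p : Place F) : 0 < placeMult p := by
  rcases p with v | w
  · rw [placeMult_inl]
    exact_mod_cast v.mult_pos
  · exact one_pos

/-- **IUTchIII:Ex3.6(ii)** (kurims p.108 l.12) "the arithmetic line bundle … determined by `𝔍`": the
`ℝ`-arithmetic divisor of `𝔍 = {λ_v·𝒪_{K_v}}_v`, with coordinate `−[F_v:ℝ]·[λ_v]` at archimedean `v` and
`−[λ_v] = −ord_v(λ_v)` at finite `v` (so `𝔍_v = 𝔭_v^{n}𝒪_v ↦ −n·v`, of degree `−n·log q_v = μ^log(𝔍_v)`).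
[claim: Mochizuki2012, status: disputed] -/
def frakDivisor (J : ModelFrakObj F) : ADivisor F :=
  Finsupp.ofSupportFinite (fun p : Place F => -(placeMult p * J.cls p.swap)) (by
    refine (J.finite.image Sum.swap).subset fun p hp => ?_
    refine ⟨p.swap, ?_, Sum.swap_swap p⟩
    intro h
    apply hp
    change -(placeMult p * J.cls p.swap) = 0
    rw [h, mul_zero, neg_zero])

/-- Coordinates of `frakDivisor 𝔍`. [claim: Mochizuki2012, status: disputed] -/
@[simp] theorem frakDivisor_apply (J : ModelFrakObj F) (p : Place F) :
    frakDivisor J p = -(placeMult p * J.cls p.swap) := rfl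

/-- `𝔍 ↦` its arithmetic divisor is a BIJECTION `𝓕⊛_𝔪𝔬𝔡`-objects `≃ ADiv_ℝ(F)` (inverse: `c_p ↦ [λ] = −c_p/weight`).
[claim: Mochizuki2012, status: disputed] -/
def frakObjEquivADivisor : ModelFrakObj F ≃ ADivisor F where
  toFun := frakDivisor
  invFun a :=
    { cls := fun v => -(a v.swap / placeMult v.swap)
      finite := by
        refine (Set.Finite.image Sum.swap (a.hasFiniteSupport : (Function.support ⇑a).Finite)).subset ?_
        intro v hv
        refine ⟨v.swap, ?_, Sum.swap_swap v⟩
        intro h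
        apply hv
        change -(a v.swap / placeMult v.swap) = 0
        rw [h, zero_div, neg_zero] }
  left_inv J := FrakObj.ext_cls <| funext fun v => by
    change -(-(placeMult v.swap * J.cls v.swap.swap) / placeMult v.swap) = J.cls v
    rw [Sum.swap_swap, neg_div, neg_neg, mul_div_cancel_left₀ _ (placeMult_pos _).ne']
  right_inv a := by
    ext p
    rw [frakDivisor_apply]
    change -(placeMult p * -(a p.swap.swap / placeMult p.swap.swap)) = a p
    rw [Sum.swap_swap, mul_neg, neg_neg, mul_comm]
    exact div_mul_cancel₀ _ (placeMult_pos _).ne'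

/-- `frakObjEquivADivisor` is `frakDivisor`. [claim: Mochizuki2012, status: disputed] -/
@[simp] theorem frakObjEquivADivisor_apply (J : ModelFrakObj F) : frakObjEquivADivisor J = frakDivisor J :=
  rfl

/-- **IUTchIII:Ex3.6(ii)** `f·𝔍`: its divisor is `frakDivisor 𝔍 − ADiv(f)` (`f·λ_v𝒪_v`: `ord` shifts by
`ord_v f`, `−log|·|_v` by `−log|f|_v`). [claim: Mochizuki2012, status: disputed] -/
theorem frakDivisor_smul (f : Fˣ) (hf : {v : ModelPlaces F | betaModel v (Additive.ofMul f) ≠ 0}.Finite)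
    (J : ModelFrakObj F) :
    frakDivisor (J.smul (β := betaModel) f hf) = frakDivisor J - ADivisor.principal (f : F) := by
  ext (v | w)
  · rw [Finsupp.sub_apply, frakDivisor_apply, frakDivisor_apply, Sum.swap_inl, placeMult_inl,
      ← mult_mul_betaModel_inr_apply]
    change -((v.mult : ℝ) * (betaModel (Sum.inr v : ModelPlaces F) (Additive.ofMul f) + J.cls (Sum.inr v))) =
      -((v.mult : ℝ) * J.cls (Sum.inr v)) - (v.mult : ℝ) * betaModel (Sum.inr v : ModelPlaces F) (Additive.ofMul f)
    ring
  · rw [Finsupp.sub_apply, frakDivisor_apply, frakDivisor_apply, Sum.swap_inr, placeMult_inr,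
      ← betaModel_inl_apply]
    change -(1 * (betaModel (Sum.inl w : ModelPlaces F) (Additive.ofMul f) + J.cls (Sum.inl w))) =
      -(1 * J.cls (Sum.inl w)) - betaModel (Sum.inl w : ModelPlaces F) (Additive.ofMul f)
    ring

/-- **IUTchIII:Ex3.6(ii)** `𝔍^{⊗n}`: its divisor is `n • frakDivisor 𝔍`. [claim: Mochizuki2012, status: disputed] -/
theorem frakDivisor_tensorPow (J : ModelFrakObj F) (n : ℤ) :
    frakDivisor (J.tensorPow n) = n • frakDivisor J := by
  ext p
  rw [Finsupp.smul_apply, frakDivisor_apply, frakDivisor_apply]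
  change -(placeMult p * (n • J.cls p.swap)) = n • -(placeMult p * J.cls p.swap)
  rw [zsmul_eq_mul, zsmul_eq_mul]
  ring

/-- **IUTchIII:Ex3.6(ii)** elementary morphisms read on divisors: `f·𝔍_{1,v} ⊆ 𝔍_{2,v}` for all `v` iff the
divisor `frakDivisor 𝔍₂ − frakDivisor 𝔍₁ + ADiv(f)` is EFFECTIVE. [claim: Mochizuki2012, status: disputed] -/
theorem isElemHom_iff_isEffective (J₁ J₂ : ModelFrakObj F) (f : Fˣ) :
    FrakObj.IsElemHom (nonneg := nonnegModel) (β := betaModel) J₁ J₂ f ↔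
      (frakDivisor J₂ - frakDivisor J₁ + ADivisor.principal (f : F)).IsEffective := by
  constructor
  · intro h p
    rw [Finsupp.add_apply, Finsupp.sub_apply, frakDivisor_apply, frakDivisor_apply]
    rcases p with v | w
    · have hv := h (Sum.inr v)
      change 0 ≤ betaModel (Sum.inr v : ModelPlaces F) (Additive.ofMul f) + J₁.cls (Sum.inr v) -
        J₂.cls (Sum.inr v) at hv
      rw [← mult_mul_betaModel_inr_apply, placeMult_inl]
      change 0 ≤ -((v.mult : ℝ) * J₂.cls (Sum.inr v)) - -((v.mult : ℝ) * J₁.cls (Sum.inr v)) +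
        (v.mult : ℝ) * betaModel (Sum.inr v : ModelPlaces F) (Additive.ofMul f)
      nlinarith [v.mult_pos, hv, (Nat.cast_pos (α := ℝ)).mpr v.mult_pos]
    · have hw := h (Sum.inl w)
      change 0 ≤ betaModel (Sum.inl w : ModelPlaces F) (Additive.ofMul f) + J₁.cls (Sum.inl w) -
        J₂.cls (Sum.inl w) at hw
      rw [← betaModel_inl_apply, placeMult_inr]
      change 0 ≤ -(1 * J₂.cls (Sum.inl w)) - -(1 * J₁.cls (Sum.inl w)) +
        betaModel (Sum.inl w : ModelPlaces F) (Additive.ofMul f)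
      linarith
  · intro h v
    change 0 ≤ betaModel v (Additive.ofMul f) + J₁.cls v - J₂.cls v
    rcases v with w | v
    · have hw := h (Sum.inr w)
      rw [Finsupp.add_apply, Finsupp.sub_apply, frakDivisor_apply, frakDivisor_apply, ← betaModel_inl_apply,
        placeMult_inr] at hw
      change 0 ≤ -(1 * J₂.cls (Sum.inl w)) - -(1 * J₁.cls (Sum.inl w)) +
        betaModel (Sum.inl w : ModelPlaces F) (Additive.ofMul f) at hw
      linarith
    · have hv := h (Sum.inl v)
      rw [Finsupp.add_apply, Finsupp.sub_apply, frakDivisor_apply, frakDivisor_apply,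
        ← mult_mul_betaModel_inr_apply, placeMult_inl] at hv
      change 0 ≤ -((v.mult : ℝ) * J₂.cls (Sum.inr v)) - -((v.mult : ℝ) * J₁.cls (Sum.inr v)) +
        (v.mult : ℝ) * betaModel (Sum.inr v : ModelPlaces F) (Additive.ofMul f) at hv
      have hm : (0 : ℝ) < v.mult := by exact_mod_cast v.mult_pos
      nlinarith [hm, hv]

/-! ### The region and the degree of `𝔍`; Proposition 3.9 (iii) for the objects of `𝓕⊛_𝔪𝔬𝔡` -/

/-- **IUTchIII:Prop3.9(iii)** (kurims p.117) the global region (element of `𝕄(𝓘^ℚ(^A𝓕_{𝕍_ℚ}))` in the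
arithmetic-divisor model) of the object `𝔍` of `𝓕⊛_𝔪𝔬𝔡`. [claim: Mochizuki2012, status: disputed] -/
def frakRegion (J : ModelFrakObj F) : GlobalRegion (divisorLogVolume F) :=
  (globalRegionEquivADivisor F).symm (frakDivisor J)

/-- **IUTchIII:Ex3.6(ii)/Prop3.9(iii)** "the degree of the arithmetic line bundle determined by `𝔍`":
`deg 𝔍 := deg_F(frakDivisor 𝔍)`. [claim: Mochizuki2012, status: disputed] -/
def frakDeg (J : ModelFrakObj F) : ℝ := degF F (frakDivisor J)

/-- **IUTchIII:Prop3.9(iii)** (kurims p.117 l.14) `μ^log(𝔍) = deg 𝔍`: the global log-volume of `𝔍`'s region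
IS the degree of its arithmetic line bundle (normalization `c = 1`). [claim: Mochizuki2012, status: disputed] -/
theorem globalLogVolume_frakRegion (J : ModelFrakObj F) :
    globalLogVolume (divisorLogVolume F) (frakRegion J) = frakDeg J :=
  globalLogVolume_symm_eq_degF F (frakDivisor J)

/-- **IUTchIII:Prop3.9(iii)** DEGREE CLAUSE for t4's own objects of `𝓕⊛_𝔪𝔬𝔡` at the model:
`Prop39iii_degree (divisorLogVolume F) frakRegion frakDeg` HOLDS (with `c = 1`).
[claim: Mochizuki2012, status: disputed] -/
theorem prop39iii_degree_frak :
    Prop39iii_degree (divisorLogVolume F) (frakRegion (F := F)) frakDeg :=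
  ⟨1, one_pos, fun J => by rw [one_mul, globalLogVolume_frakRegion]⟩

/-- **IUTchIII:Ex3.6(ii) ↔ Prop3.9(iii)**: t4's Example-3.6 action `𝔍 ↦ f·𝔍` IS the bridge's
`principalAction f` on global regions. [claim: Mochizuki2012, status: disputed] -/
theorem frakRegion_smul (f : Fˣ) (hf : {v : ModelPlaces F | betaModel v (Additive.ofMul f) ≠ 0}.Finite)
    (J : ModelFrakObj F) :
    frakRegion (J.smul (β := betaModel) f hf) = principalAction F f (frakRegion J) := by
  apply (globalRegionEquivADivisor F).injective
  rw [globalRegionEquivADivisor_principalAction, frakRegion, frakRegion, Equiv.apply_symm_apply,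
    Equiv.apply_symm_apply, frakDivisor_smul]

/-- **IUTchIII:Prop3.9(iii)** INVARIANCE CLAUSE for t4's own objects: `μ^log(f·𝔍) = μ^log(𝔍)` for every
`f ∈ F^×` (product formula, via `prop39iii_invariance_divisorModel`). [claim: Mochizuki2012, status: disputed] -/
theorem globalLogVolume_frakRegion_smul (f : Fˣ)
    (hf : {v : ModelPlaces F | betaModel v (Additive.ofMul f) ≠ 0}.Finite) (J : ModelFrakObj F) :
    globalLogVolume (divisorLogVolume F) (frakRegion (J.smul (β := betaModel) f hf)) =
      globalLogVolume (divisorLogVolume F) (frakRegion J) := by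
  rw [frakRegion_smul, globalLogVolume_principalAction]

/-- `deg(f·𝔍) = deg 𝔍` (`deg_F(ADiv(f)) = 0`). [claim: Mochizuki2012, status: disputed] -/
theorem frakDeg_smul (f : Fˣ) (hf : {v : ModelPlaces F | betaModel v (Additive.ofMul f) ≠ 0}.Finite)
    (J : ModelFrakObj F) : frakDeg (J.smul (β := betaModel) f hf) = frakDeg J := by
  rw [← globalLogVolume_frakRegion, ← globalLogVolume_frakRegion, globalLogVolume_frakRegion_smul]

/-- `deg(𝔍^{⊗n}) = n · deg 𝔍`. [claim: Mochizuki2012, status: disputed] -/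
theorem frakDeg_tensorPow (J : ModelFrakObj F) (n : ℤ) : frakDeg (J.tensorPow n) = n * frakDeg J := by
  rw [frakDeg, frakDeg, frakDivisor_tensorPow, map_zsmul, zsmul_eq_mul]

/-- Degrees INCREASE along elementary morphisms of `𝓕⊛_𝔪𝔬𝔡`: `f·𝔍₁ ⊆ 𝔍₂` ⇒ `deg 𝔍₁ ≤ deg 𝔍₂`
(`deg 𝔍₂ − deg 𝔍₁ = deg_F(effective divisor) ≥ 0` by the product formula `deg_F(ADiv f) = 0`).
[claim: Mochizuki2012, status: disputed] -/
theorem frakDeg_le_of_isElemHom {J₁ J₂ : ModelFrakObj F} {f : Fˣ}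
    (h : FrakObj.IsElemHom (nonneg := nonnegModel) (β := betaModel) J₁ J₂ f) : frakDeg J₁ ≤ frakDeg J₂ := by
  have hnn := degF_nonneg F ((isElemHom_iff_isEffective J₁ J₂ f).mp h)
  rw [map_add, map_sub, degF_principal, add_zero] at hnn
  rw [frakDeg, frakDeg]
  linarith

/-- Degrees along general morphisms (`(𝔍₁)^{⊗n} → 𝔍₂` elementary, Frobenius degree `n`):
`n · deg 𝔍₁ ≤ deg 𝔍₂`. [claim: Mochizuki2012, status: disputed] -/
theorem frakDeg_mul_le_of_isHom {J₁ J₂ : ModelFrakObj F} {n : ℕ+} {f : Fˣ}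
    (h : FrakObj.IsHom (nonneg := nonnegModel) (β := betaModel) J₁ J₂ n f) :
    (n : ℝ) * frakDeg J₁ ≤ frakDeg J₂ := by
  have := frakDeg_le_of_isElemHom h
  rw [frakDeg_tensorPow] at this
  exact_mod_cast this

/-! ### Remark 3.10.1 (iii): estimating degrees by log-volumes -/

/-- Containment of global regions in the arithmetic-divisor model: coordinatewise (at every place the ball of
`S` is contained in the ball of `S'`, i.e. `c_v ≤ c'_v`). An instance on the MODEL type only.
[claim: Mochizuki2012, status: disputed] -/
instance instHasSubsetGlobalRegion : HasSubset (GlobalRegion (divisorLogVolume F)) :=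
  ⟨fun S S' => ∀ p, S.1 p ≤ S'.1 p⟩

/-- Unfolding the containment. [claim: Mochizuki2012, status: disputed] -/
theorem globalRegion_subset_iff (S S' : GlobalRegion (divisorLogVolume F)) :
    S ⊆ S' ↔ ∀ p, S.1 p ≤ S'.1 p := Iff.rfl

/-- The global log-volume is MONOTONE for containment (all weights `deg_F(v) > 0`).
[claim: Mochizuki2012, status: disputed] -/
theorem globalLogVolume_mono {S S' : GlobalRegion (divisorLogVolume F)} (h : S ⊆ S') :
    globalLogVolume (divisorLogVolume F) S ≤ globalLogVolume (divisorLogVolume F) S' := by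
  have hnn : (globalRegionEquivADivisor F S' - globalRegionEquivADivisor F S).IsEffective := fun p => by
    rw [Finsupp.sub_apply, globalRegionEquivADivisor_apply, globalRegionEquivADivisor_apply]
    exact sub_nonneg.mpr (h p)
  have := degF_nonneg F hnn
  rw [map_sub] at this
  rw [globalLogVolume_eq_degF, globalLogVolume_eq_degF]
  linarith

/-- **IUTchIII:Rmk3.10.1(iii)** (kurims p.150 l.36) "one may nevertheless compute — i.e., … 'estimate' — the
global arithmetic degrees of objects of '`𝓕⊛_𝔪𝔬𝔡`' by computing log-volumes": t4's typed
`Remark3101iii_estimate` HOLDS at the model — if the region of `𝔍` is contained in a global region `S` then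
`deg 𝔍 ≤ μ^log(S)`. [claim: Mochizuki2012, status: disputed] -/
theorem remark3101iii_estimate_frak :
    Remark3101iii_estimate (frakDeg (F := F)) frakRegion (globalLogVolume (divisorLogVolume F)) := by
  intro J S h
  rw [← globalLogVolume_frakRegion]
  exact globalLogVolume_mono h

end Literature.IUT.LogThetaLattice
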